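import Summits.Ventures.HodgeRepro2.T5SU11KernelCompositionCorner
import Summits.Ventures.HodgeRepro2.T5SU11KernelUniformBounds
import Summits.Ventures.HodgeRepro2.T5SU11KernelCompositionSymmetric
import Summits.Ventures.HodgeRepro2.T5SU11SphericalMonotone

/-!
# The first composed kernel satisfies the two-sided `Ξ`-bound on all of `(0, ∞)²`: `|K_λ^{∘2}(t, s)| ≤ C Ξ(t) Ξ(s)`

The kernel itself does NOT satisfy a bound `|K_λ(t, s)| ≤ C Ξ(t) Ξ(s)` on the whole quadrant (row 603: the corner singularity).
Its first composition does: away from the corner row 602 gives `|K_λ^{∘2}(t, s)| ≤ C Ξ(t) Ξ(s)/(λ − 1)²` for `max(t, s) ≥ 1`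
(with the symmetry of row 582), and on the corner square row 645's bound `Φ² ∫ χ_λ² sinh 2r dr` is dominated by
`(Φ² ∫ χ_λ² sinh 2r dr / Ξ(1)²) Ξ(t) Ξ(s)` since `Ξ ≥ Ξ(1) > 0` on `(0, 1]`:

* `exists_abs_kernel_comp_two_le_mul_sph_one` — **`∃ C > 0, ∀ t, s > 0, |K_λ^{∘2}(t, s)| ≤ C Ξ(t) Ξ(s)`**;
* `exists_abs_kernel_comp_two_le` — in particular **`K_λ^{∘2}` is bounded on `(0, ∞)²`** (`Ξ ≤ 1`).

Nothing is claimed about (N).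

Blind lane: Mathlib + the HodgeRepro2 prefix only; no sorry; axioms ⊆ {propext, Classical.choice,
Quot.sound}.
-/

namespace Summit.Ventures.HodgeRepro2.T5SU11KernelCompositionTwoSidedGlobal

open Filter Topology MeasureTheory
open Set (Ioi Ioc Icc Ici)
open T5SU11Cartan T5SU11SphericalFunction T5SU11SphericalBounds T5SU11SphericalMonotone T5SU11SphericalDecay
  T5SU11RadialGreenKernel T5SU11RadialGreenImproper T5SU11RadialGreenImproperOrigin T5SU11KernelUniformBounds
  T5SU11KernelCompositionSymmetric T5SU11KernelCompositionCorner

section measure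

variable [MeasurableSpace Circle] [BorelSpace Circle]

variable {lam : ℝ} (hlam : 1 < lam)

include hlam in
/-- **THE FIRST COMPOSED KERNEL SATISFIES THE TWO-SIDED `Ξ`-BOUND GLOBALLY**: `∃ C > 0, |K_λ^{∘2}(t, s)| ≤ C Ξ(t) Ξ(s)` for all
`t, s > 0`. -/
theorem exists_abs_kernel_comp_two_le_mul_sph_one :
    ∃ C : ℝ, 0 < C ∧ ∀ t s, 0 < t → 0 < s →
      |((greenSolI (fun t => sph lam (hyp t)) (sphDecay lam))^[1] (fun r => sphGreenKernel lam r s)) t|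
        ≤ C * sph 1 (hyp t) * sph 1 (hyp s) := by
  obtain ⟨C₁, hC₁, hC₁'⟩ := exists_kernel_comp_le_uniform hlam one_pos
  obtain ⟨Φ, hΦ0, hΦ⟩ := exists_sph_hyp_le lam
  set I := ∫ r in Ioi 0, sphDecay lam r * sphDecay lam r * Real.sinh (2 * r) with hI
  have hI0 : 0 ≤ I := setIntegral_nonneg measurableSet_Ioi fun r hr => by
    have hr' : (0 : ℝ) < r := hr
    exact mul_nonneg (mul_nonneg (sphDecay_pos hlam hr').le (sphDecay_pos hlam hr').le)
      (T5SU11ReductionOfOrder.sinh_two_mul_pos hr').le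
  have hΞ1 : 0 < sph 1 (hyp 1) := sph_hyp_pos 1 1
  set C₂ := Φ ^ 2 * I / sph 1 (hyp 1) ^ 2 with hC₂
  have hC₂0 : 0 ≤ C₂ := by positivity
  refine ⟨max (C₁ / (lam - 1) ^ 2) C₂ + 1, by positivity, fun t s ht hs => ?_⟩
  have hΞt : 0 < sph 1 (hyp t) := sph_hyp_pos 1 t
  have hΞs : 0 < sph 1 (hyp s) := sph_hyp_pos 1 s
  have hmax1 : C₁ / (lam - 1) ^ 2 ≤ max (C₁ / (lam - 1) ^ 2) C₂ + 1 := by linarith [le_max_left (C₁ / (lam - 1) ^ 2) C₂]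
  have hmax2 : C₂ ≤ max (C₁ / (lam - 1) ^ 2) C₂ + 1 := by linarith [le_max_right (C₁ / (lam - 1) ^ 2) C₂]
  have hΞΞ : 0 ≤ sph 1 (hyp t) * sph 1 (hyp s) := (mul_pos hΞt hΞs).le
  rcases le_or_gt 1 s with hs1 | hs1
  · -- `s ≥ 1`: row 602
    have h := hC₁' 1 t s ht hs1
    simp only [pow_one] at h
    calc _ ≤ C₁ * sph 1 (hyp s) * sph 1 (hyp t) / (lam - 1) ^ 2 := h
      _ = C₁ / (lam - 1) ^ 2 * (sph 1 (hyp t) * sph 1 (hyp s)) := by ring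
      _ ≤ (max (C₁ / (lam - 1) ^ 2) C₂ + 1) * (sph 1 (hyp t) * sph 1 (hyp s)) :=
          mul_le_mul_of_nonneg_right hmax1 hΞΞ
      _ = (max (C₁ / (lam - 1) ^ 2) C₂ + 1) * sph 1 (hyp t) * sph 1 (hyp s) := by ring
  · rcases le_or_gt 1 t with ht1 | ht1
    · -- `t ≥ 1 > s`: row 602 after the symmetry of row 582
      have h := hC₁' 1 s t hs ht1
      simp only [pow_one] at h
      rw [kernel_comp_symm hlam 1 ht hs]
      calc _ ≤ C₁ * sph 1 (hyp t) * sph 1 (hyp s) / (lam - 1) ^ 2 := h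
        _ = C₁ / (lam - 1) ^ 2 * (sph 1 (hyp t) * sph 1 (hyp s)) := by ring
        _ ≤ (max (C₁ / (lam - 1) ^ 2) C₂ + 1) * (sph 1 (hyp t) * sph 1 (hyp s)) :=
            mul_le_mul_of_nonneg_right hmax1 hΞΞ
        _ = (max (C₁ / (lam - 1) ^ 2) C₂ + 1) * sph 1 (hyp t) * sph 1 (hyp s) := by ring
    · -- the corner square: row 645 and `Ξ ≥ Ξ(1)` on `(0, 1]`
      have h := abs_kernel_comp_two_le_corner hlam hΦ hΦ0.le ht ht1.le hs hs1.le
      have hΞt1 : sph 1 (hyp 1) ≤ sph 1 (hyp t) :=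
        strictAntiOn_sph_one_hyp.antitoneOn (Set.mem_Ici.mpr ht.le) (Set.mem_Ici.mpr zero_le_one) ht1.le
      have hΞs1 : sph 1 (hyp 1) ≤ sph 1 (hyp s) :=
        strictAntiOn_sph_one_hyp.antitoneOn (Set.mem_Ici.mpr hs.le) (Set.mem_Ici.mpr zero_le_one) hs1.le
      have hprod : sph 1 (hyp 1) ^ 2 ≤ sph 1 (hyp t) * sph 1 (hyp s) := by
        rw [sq]
        exact mul_le_mul hΞt1 hΞs1 hΞ1.le hΞt.le
      calc _ ≤ Φ ^ 2 * I := h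
        _ = C₂ * sph 1 (hyp 1) ^ 2 := by
            rw [hC₂]
            field_simp
        _ ≤ C₂ * (sph 1 (hyp t) * sph 1 (hyp s)) := mul_le_mul_of_nonneg_left hprod hC₂0
        _ ≤ (max (C₁ / (lam - 1) ^ 2) C₂ + 1) * (sph 1 (hyp t) * sph 1 (hyp s)) :=
            mul_le_mul_of_nonneg_right hmax2 hΞΞ
        _ = (max (C₁ / (lam - 1) ^ 2) C₂ + 1) * sph 1 (hyp t) * sph 1 (hyp s) := by ring

include hlam in
/-- **`K_λ^{∘2}` is bounded on `(0, ∞)²`**. -/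
theorem exists_abs_kernel_comp_two_le :
    ∃ C : ℝ, 0 < C ∧ ∀ t s, 0 < t → 0 < s →
      |((greenSolI (fun t => sph lam (hyp t)) (sphDecay lam))^[1] (fun r => sphGreenKernel lam r s)) t| ≤ C := by
  obtain ⟨C, hC, h⟩ := exists_abs_kernel_comp_two_le_mul_sph_one hlam
  refine ⟨C, hC, fun t s ht hs => le_trans (h t s ht hs) ?_⟩
  have h1 : sph 1 (hyp t) ≤ 1 := sph_hyp_le_one zero_le_one one_le_two t
  have h2 : sph 1 (hyp s) ≤ 1 := sph_hyp_le_one zero_le_one one_le_two s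
  have h1' : 0 < sph 1 (hyp t) := sph_hyp_pos 1 t
  have h2' : 0 < sph 1 (hyp s) := sph_hyp_pos 1 s
  calc C * sph 1 (hyp t) * sph 1 (hyp s) ≤ C * 1 * 1 :=
        mul_le_mul (mul_le_mul_of_nonneg_left h1 hC.le) h2 h2'.le (by positivity)
    _ = C := by ring

end measure

end Summit.Ventures.HodgeRepro2.T5SU11KernelCompositionTwoSidedGlobal
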